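import Summits.KontsevichZagierPeriods.KontsevichZagierPeriods.Theses.IsogenyCertificates
import Summits.KontsevichZagierPeriods.KontsevichZagierPeriods.Theorems.XMapKernel.Negative.Core
import Summits.KontsevichZagierPeriods.KontsevichZagierPeriods.Theorems.IsogenyCertificatesXMapPeriodTransfer
import Summits.KontsevichZagierPeriods.KontsevichZagierPeriods.Theorems.IsogenyCertificatesXMapKernelStubDerivedDatum
import Summits.KontsevichZagierPeriods.KontsevichZagierPeriods.Theorems.IsogenyCertificatesXMapKernelStubWeightedCellMove
import Summits.KontsevichZagierPeriods.KontsevichZagierPeriods.Theorems.IsogenyCertificatesXMapKernelStubHermiteMoveRat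
import Summits.KontsevichZagierPeriods.KontsevichZagierPeriods.Theorems.IsogenyCertificatesXMapKernelStubQuasiTransferEngine
import Summits.KontsevichZagierPeriods.KontsevichZagierPeriods.Theorems.IsogenyCertificatesXMapKernelStubEtaCellCollapse
import Summits.KontsevichZagierPeriods.KontsevichZagierPeriods.Theorems.IsogenyCertificatesXMapKernelStubEtaIndependence
import Summits.KontsevichZagierPeriods.KontsevichZagierPeriods.Theorems.IsogenyCertificatesXMapKernelStubEtaIndependenceNonCM
import Summits.KontsevichZagierPeriods.KontsevichZagierPeriods.Theorems.IsogenyCertificatesXMapKernelStubCMClassEta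
import Summits.KontsevichZagierPeriods.KontsevichZagierPeriods.Theorems.IsogenyCertificatesXMapKernelStubEggBridge

/-!
# `XMapKernel` (stmt-KontsevichZagierPeriods-10663, route IsogenyCertificates) — line `derived-datum-quasi-periods`:
the (ω, η)-EGG CELL of the crux, ASSEMBLED (lead prover c2, from lead c1's landed stubs)

Lead c1 drove the line `derived-datum-quasi-periods` to "closed modulo {HW, K}": every stub of its registered
skeleton is a theorem of the tree (`…StubDerivedDatum` p103719, `…StubWeightedCellMove` p103682,
`…StubHermiteMoveRat`, `…StubEtaCellCollapse` p103538, `…StubEtaIndependence` p105495 with `…NonCM` p111121,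
`…StubCMClassEta` p109187, `…StubEggBridge` p108297, `…StubQuasiTransferEngine` p112240) except the named fact
`HuberWustholzManyCurvePeriods` (HW: Huber–Wüstholz 2022 Thm 15.3, Wüstholz's analytic subgroup theorem — unproved
in the tree) and the remainder K (`stub_offCellReduction`). The COMPOSITION, however, lived only in the Cruxes
skeleton. This file assembles it into declarations of the tree:

* `etaIndependence` — conditionally on HW, the real periods AND real quasi-periods `Ω_egg, H_egg` of finitely many
  three-real-root integral cubics pairwise not joined by an egg-regular coprime x-rational isogeny datum are
  `ℚ`-linearly independent (c1's reduction `stub_etaIndependence_of` fed with the landed class independence —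
  non-CM and CM halves — and the egg bridge);
* `etaCellKernel` — **the (ω, η)-egg cell**: conditionally on HW, every formal `ℤ`-combination of the
  representations `[egg(A,B), (a₀ + a₁x)/√(x³+Ax+B)]` (`4A³+27B² < 0`, `a₀, a₁ ∈ ℚ`) with value `0` is a RELATION
  of the four-move KZ calculus (`KZ.relations` — no x-map relator is used: this is a cell of the kernel
  conjecture itself), by the engine (DD + weighted cell moves + one rational Hermite move) and `etaIndependence`;
* `xMapKernel_iff_offCellReduction` — given HW, the crux is EQUIVALENT to the line's remainder K;
* `offCellReduction_iff_summit` — hence K is the summit `KontsevichZagierPeriods` (the crux is the summit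
  unconditionally: Disproof F1 `iff_summit_of_transfer` ∘ the proved `XMapPeriodTransfer_of`).

No statement of the tree is changed; theorems only.
-/

noncomputable section

namespace Summit.KontsevichZagierPeriods.IsogenyCertificates.XMapKernelEtaCell

open scoped BigOperators
open Polynomial
open Literature.NumberTheory.Transcendental
open Summit.KontsevichZagierPeriods.KontsevichZagierPeriods.Theses.IsogenyCertificates
open Summit.KontsevichZagierPeriods.IsogenyCertificates.XMapKernelStubs
open Summit.KontsevichZagierPeriods.XMapKernel.Negative
open Set MeasureTheory

/-- **η-independence, conditional on Huber–Wüstholz** (the registered stub `stub_etaIndependence` of the line,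
under the named fact): for finitely many three-real-root integral cubics pairwise NOT joined by an egg-regular
coprime x-rational isogeny datum, the numbers `Ω_egg(i) = ∫_egg dx/√Pᵢ` and `H_egg(i) = ∫_egg x dx/√Pᵢ` are
`ℚ`-linearly independent. Assembled from c1's landed reduction `EtaIndependence.stub_etaIndependence_of` (HW +
class independence with quasi-periods + egg bridge ⇒ this), the class independence
`EtaIndependence.classIndependence_of_cm` (non-CM half proved there, CM half `CMClassEta.stub_cmClassEta`) and the
bridge `EggBridge.stub_eggBridge`. [cite: HuberWustholz2022, Thm. 15.3] -/
theorem etaIndependence : Literature.NumberTheory.Transcendental.HuberWustholzManyCurvePeriods → ∀ (k : ℕ) (A B : Fin k → ℤ) (p q : Fin k → ℚ), (∀ i, 4 * A i ^ 3 + 27 * B i ^ 2 < 0) → (∀ i j, i ≠ j → ¬ ∃ (f g : ℚ[X]) (c : ℚ), IsCoprime f g ∧ derivative f * g - f * derivative g ≠ 0 ∧ C (c ^ 2) * g * (f ^ 3 + C (A j : ℚ) * f * g ^ 2 + C (B j : ℚ) * g ^ 3) = (X ^ 3 + C (A i : ℚ) * X + C (B i : ℚ)) * (derivative f * g - f * derivative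 g) ^ 2 ∧ ∀ y ∈ closure ({y : ℝ | 0 < y ^ 3 + (A i : ℝ) * y + (B i : ℝ)} \ connectedComponentIn {y : ℝ | 0 < y ^ 3 + (A i : ℝ) * y + (B i : ℝ)} (1 + |(A i : ℝ)| + |(B i : ℝ)|)), aeval y g ≠ 0) → ∑ i, ((p i : ℝ) * (∫ x in {x : Fin 1 → ℝ | x 0 ∈ {y : ℝ | 0 < y ^ 3 + (A i : ℝ) * y + (B i : ℝ)} \ connectedComponentIn {y : ℝ | 0 < y ^ 3 + (A i : ℝ) * y + (B i : ℝ)} (1 + |(A i : ℝ)| + |(B i : ℝ)|)}, 1 / Real.sqrt (x 0 ^ 3 + (A i : ℝ) * x 0 + (B i : ℝ))) + (q i : ℝ) * (∫ x in {x : Fin 1 → ℝ | x 0 ∈ {y : ℝ | 0 < y ^ 3 + (A i : ℝ) * y + (B i : ℝ)} \ connectedComponentIn {y : ℝ | 0 < y ^ 3 + (A i : ℝ) * y + (B i : ℝ)} (1 + |(A i : ℝ)| + |(B i : ℝ)|)}, x 0 / Real.sqrt (x 0 ^ 3 + (A i : ℝ) * x 0 + (B i : ℝ)))) = 0 → ∀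 i, p i = 0 ∧ q i = 0 := fun hHW =>
  EtaIndependence.stub_etaIndependence_of hHW
    (EtaIndependence.classIndependence_of_cm CMClassEta.stub_cmClassEta) EggBridge.stub_eggBridge

/-- **The (ω, η)-egg cell of `XMapKernel`, conditional on Huber–Wüstholz.** Every element of value `0` of the
subgroup generated by the egg representations `[egg(A,B), (a₀ + a₁x)/√(x³+Ax+B)]` (`4A³+27B² < 0`,
`a₀, a₁ ∈ ℚ`) lies in `KZ.relations`: all `ℚ`-linear relations among real periods and real quasi-periods of
three-real-root integral cubics are generated by the four KZ moves. The line's lever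
`EtaCellCollapse.stub_etaCellCollapse` fed with the engine `QuasiEngine.stub_quasiTransferEngine` (itself fed with
`DerivedDatum.stub_derivedDatum`, `WeightedCellMove.stub_weightedCellMove`, `HermiteMoveRat.stub_hermiteMoveRat`)
and `etaIndependence`. [cite: KontsevichZagier2001, §1.2] -/
theorem etaCellKernel : Literature.NumberTheory.Transcendental.HuberWustholzManyCurvePeriods → ∀ c ∈ AddSubgroup.closure {d : KZ.FormalRep | ∃ (A B : ℤ) (a₀ a₁ : ℚ) (r : KZ.IntegralRep 1), 4 * A ^ 3 + 27 * B ^ 2 < 0 ∧ r.domain = {x | x 0 ∈ {y : ℝ | 0 < y ^ 3 + (A : ℝ) * y + (B : ℝ)} \ connectedComponentIn {y : ℝ | 0 < y ^ 3 + (A : ℝ) * y + (B : ℝ)} (1 + |(A : ℝ)| + |(B : ℝ)|)} ∧ EqOn r.integrand (fun x => ((a₀ : ℝ) + (a₁ : ℝ) * x 0) / Real.sqrt (x 0 ^ 3 + (A : ℝ) * x 0 + (B : ℝ))) r.domain ∧ d = KZ.of r}, KZ.eval c = 0 → c ∈ KZ.relations := by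
  intro hHW
  obtain ⟨hReps, hEngine⟩ := QuasiEngine.stub_quasiTransferEngine DerivedDatum.stub_derivedDatum
    WeightedCellMove.stub_weightedCellMove HermiteMoveRat.stub_hermiteMoveRat
  exact EtaCellCollapse.stub_etaCellCollapse hReps hEngine (etaIndependence hHW)

/-- **What the line leaves open.** Conditionally on Huber–Wüstholz, the crux `XMapKernel` is EQUIVALENT to the
line's remainder K (`stub_offCellReduction`: every kernel element is congruent modulo `closure gens` to an element
of the (ω, η)-egg sector): `→` with the sector element `0`; `←` by the cell (`KZ.relations ≤ closure gens`) and
soundness `closure_gens_le_ker_eval`. [folklore] -/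
theorem xMapKernel_iff_offCellReduction : Literature.NumberTheory.Transcendental.HuberWustholzManyCurvePeriods → (Summit.KontsevichZagierPeriods.KontsevichZagierPeriods.Theses.IsogenyCertificates.XMapKernel ↔ ∀ c : KZ.FormalRep, KZ.eval c = 0 → ∃ c' ∈ AddSubgroup.closure {d : KZ.FormalRep | ∃ (A B : ℤ) (a₀ a₁ : ℚ) (r : KZ.IntegralRep 1), 4 * A ^ 3 + 27 * B ^ 2 < 0 ∧ r.domain = {x | x 0 ∈ {y : ℝ | 0 < y ^ 3 + (A : ℝ) * y + (B : ℝ)} \ connectedComponentIn {y : ℝ | 0 < y ^ 3 + (A : ℝ) * y + (B : ℝ)} (1 + |(A : ℝ)| + |(B : ℝ)|)} ∧ EqOn r.integrand (fun x => ((a₀ : ℝ) + (a₁ : ℝ) * x 0) / Real.sqrt (x 0 ^ 3 + (A : ℝ) * x 0 + (B : ℝ))) r.domain ∧ d = KZ.of r}, c - c' ∈ AddSubgroup.closure Summit.KontsevichZagierPeriods.XMapKernel.Negative.gens) := by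
  intro hHW
  rw [crux_iff]
  constructor
  · intro hX c hc
    exact ⟨0, AddSubgroup.zero_mem _, by simpa using hX c hc⟩
  · intro hK c hc
    obtain ⟨c', hc', hcc'⟩ := hK c hc
    have hdiff : KZ.eval (c - c') = 0 := AddMonoidHom.mem_ker.1 (closure_gens_le_ker_eval hcc')
    have hc'0 : KZ.eval c' = 0 := by
      rw [map_sub, hc, zero_sub, neg_eq_zero] at hdiff
      exact hdiff
    have hc'mem : c' ∈ AddSubgroup.closure gens := relations_le_closure_gens (etaCellKernel hHW c' hc' hc'0)
    have : c = (c - c') + c' := by abel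
    rw [this]
    exact AddSubgroup.add_mem _ hcc' hc'mem

/-- **The remainder is the summit.** Conditionally on Huber–Wüstholz, the line's remainder K is EQUIVALENT to
`KontsevichZagierPeriods` — the crux being the summit unconditionally (Disproof F1
`XMapKernel.Negative.iff_summit_of_transfer` composed with the proved sibling crux
`XMapPeriodTransferCells.XMapPeriodTransfer_of`). So the line is complete short of the period conjecture itself.
[folklore] -/
theorem offCellReduction_iff_summit : Literature.NumberTheory.Transcendental.HuberWustholzManyCurvePeriods → ((∀ c : KZ.FormalRep, KZ.eval c = 0 → ∃ c' ∈ AddSubgroup.closure {d : KZ.FormalRep | ∃ (A B : ℤ) (a₀ a₁ : ℚ) (r : KZ.IntegralRep 1), 4 * A ^ 3 + 27 * B ^ 2 < 0 ∧ r.domain = {x | x 0 ∈ {y : ℝ | 0 < y ^ 3 + (A : ℝ) * y + (B : ℝ)} \ connectedComponentIn {y : ℝ | 0 < y ^ 3 + (A : ℝ) * y + (B : ℝ)} (1 + |(A : ℝ)| + |(B : ℝ)|)} ∧ EqOn r.integrand (fun x => ((a₀ : ℝ) + (a₁ : ℝ) * x 0) / Real.sqrt (x 0 ^ 3 + (A :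 ℝ) * x 0 + (B : ℝ))) r.domain ∧ d = KZ.of r}, c - c' ∈ AddSubgroup.closure Summit.KontsevichZagierPeriods.XMapKernel.Negative.gens) ↔ KontsevichZagierPeriods) := fun hHW =>
  (xMapKernel_iff_offCellReduction hHW).symm.trans
    (iff_summit_of_transfer
      Summit.KontsevichZagierPeriods.IsogenyCertificates.XMapPeriodTransferCells.XMapPeriodTransfer_of)

end Summit.KontsevichZagierPeriods.IsogenyCertificates.XMapKernelEtaCell

end
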